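import Mathlib
import HarnessLib
import Summits.CriticalPhenomena.SAWScalingLimit.Theses.SAWStressTensor
import Literature.Probability.LatticeModels.KilledWalkGreen

/-!
# Line `birth` — registered skeleton for the crux `QuadrupoleShape` (stmt-CriticalPhenomena-7750)

Crux (FIXED; rank 2 of `route-CriticalPhenomena-SAWStressTensor`): there are mesh-only amplitudes
`A₁ A₂ : ℝ → ℝ` such that for every Dobrushin domain `(Ω; a, b)`, endpoint approximation `a_δ, b_δ`,
interior point `z₀` with lattice sites `z_δ`, `δ z_δ → z₀`, and chordal uniformizer `φ : ℍ → Ω`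
(`0 ↦ a`, `∞ ↦ b`; `ψ = φ⁻¹`), the normalised one-point functions of the two `D₄` occupation
quadrupoles of the critical `δℤ²` SAW converge to the h-free stress-tensor shape:
`E_δ[X₁(z_δ)]/A₁(δ) → Re (ψ′(z₀)/ψ(z₀))²`, `E_δ[X₂(z_δ)]/A₂(δ) → Im (ψ′(z₀)/ψ(z₀))²`.

## The cut (the route header's own remark "η = nil recovers QuadrupoleShape once the RW shape
## converges to the conformal one", made into two named lemmas)

* S1 `stub_latticeShape` — THE LATTICE-INTRINSIC SHAPE (open-problem content; no conformal map in
  the statement): with the SAME amplitudes, `E_δ[X_i(z_δ)]/A_i(δ)` is asymptotic to the real /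
  imaginary part of `(D_z L_δ)(z_δ)²`, where `L_δ(p) = log (G_δ(p, b_δ) / G_δ(p, a_δ))`, `G_δ` the Green
  function of simple random walk on `Ω_δ` killed at its first step that is not an edge of `Ω_δ`
  (`killedRegionGreen (discreteDomainGraph Ω δ) (meshDomain Ω δ)`), and
  `D_z L = [(L(p+e₁) − L(p−e₁)) − i (L(p+e₂) − L(p−e₂))]/(4δ)` is the discrete `∂_z`. This is the
  slit-free (`η = nil`, tip `v = a_δ`) specialisation of the route's rank-3 crux `SlitQuadrupoleShape`,
  read along interior sequences: every local lattice factor, the normalisation of the Green functions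
  and the log-partner amplitude cancel under `∂ log`, so the statement is amplitude-free too.
* S2 `stub_greenLogGradient` — THE RANDOM-WALK SHAPE CONVERGES TO THE CONFORMAL SHAPE (discrete
  potential theory, no SAW): `(D_z L_δ)(z_δ) → ψ′(z₀)/ψ(z₀)`. Continuum: `G_Ω(·, b_δ)`, `G_Ω(·, a_δ)`
  normalised at an interior point converge to the Martin (= Poisson, Ω Jordan) kernels at `b`, `a`,
  which in the chart `w = ψ(z)` are `c · Im w` and `c′ · Im (−1/w) = c′ · Im w / |w|²`; their ratio is
  `|ψ|²` up to a constant, so `L = 2 Re log ψ + const` and `∂_z L = ψ′/ψ` (`∂_z` kills the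
  anti-holomorphic half). Lattice: ChelkakSmirnov2011 Thm 3.10 (arXiv:0810.2188 p. 14: discrete
  Poisson kernels normalised at an interior point are uniformly `C¹`-close to the continuous ones in
  arbitrary rough simply connected discrete domains — values AND discrete gradients), applied to the
  two normalised Green columns `G_δ(·, b_δ)/G_δ(v, b_δ)`, `G_δ(·, a_δ)/G_δ(v, a_δ)` and then to the log of
  their ratio; the one point beyond the toolbox is that the poles `a_δ`, `b_δ` of an endpoint
  approximation may sit strictly INSIDE `Ω_δ` while tending to the prime ends (moving interior poles:
  weak Beurling + Harnack as in KozdronLawler2005 / LawlerSchrammWerner2004, or a last-exit reduction to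
  boundary poles).

`QuadrupoleShape_of` (kernel-checked, no `sorry` of its own): square S2, take real and imaginary
parts (continuity), add to S1 (`(E/A − Re S_δ) + Re S_δ`), and rewrite `(ψ′/ψ)² = ψ′²/ψ²`
(`div_pow`); hypotheses = the two stubs under their registered names, conclusion = the route decl
`Summit.CriticalPhenomena.SAWScalingLimit.Theses.SAWStressTensor.QuadrupoleShape` BY NAME.

Both stubs are stated in TREE VOCABULARY ONLY (`SAW.law`, `SAW.DomainSAW`, `SAW.IsEndpointApprox`,
`killedRegionGreen`, `discreteDomainGraph`, `meshDomain`, `meshPoint`, `ConformalEquiv`,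
`MarkedDomain.IsChordalUniformizing`, with the quadrupole indicators and the RW shape as inlined
`let`s exactly as in the crux), so each lands verbatim as
`Theorems/SAWStressTensorQuadrupoleShape<Stub>.lean --supports stmt-CriticalPhenomena-7750`.
-/

noncomputable section

open MeasureTheory Filter Topology Set
open Literature.Probability.RandomPlanarGeometry Literature.Probability.LatticeModels

namespace Summit.CriticalPhenomena.SAWScalingLimit.Cruxes.QuadrupoleShape.Birth

/-! ### Vocabulary of the line (proof-side abbreviations; the stubs themselves inline everything) -/

/-- Channel B1 (`~ T_xx − T_yy`): straight-horizontal minus straight-vertical passage of `γ` at `v`. -/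
def quadB1 {Ω : Set ℂ} {δ : ℝ} {a b : Site 2} (v : Site 2) (γ : SAW.DomainSAW Ω δ a b) : ℝ :=
  (if s(v - ![1, 0], v) ∈ γ.walk.edges ∧ s(v, v + ![1, 0]) ∈ γ.walk.edges then (1 : ℝ) else 0) -
    (if s(v - ![0, 1], v) ∈ γ.walk.edges ∧ s(v, v + ![0, 1]) ∈ γ.walk.edges then (1 : ℝ) else 0)

/-- Channel B2 (`~ T_xy`): (NE-or-SW turn) minus (NW-or-SE turn) of `γ` at `v`. -/
def quadB2 {Ω : Set ℂ} {δ : ℝ} {a b : Site 2} (v : Site 2) (γ : SAW.DomainSAW Ω δ a b) : ℝ :=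
  (if (s(v, v + ![1, 0]) ∈ γ.walk.edges ∧ s(v, v + ![0, 1]) ∈ γ.walk.edges) ∨
        (s(v - ![1, 0], v) ∈ γ.walk.edges ∧ s(v - ![0, 1], v) ∈ γ.walk.edges) then (1 : ℝ) else 0) -
    (if (s(v - ![1, 0], v) ∈ γ.walk.edges ∧ s(v, v + ![0, 1]) ∈ γ.walk.edges) ∨
        (s(v, v + ![1, 0]) ∈ γ.walk.edges ∧ s(v - ![0, 1], v) ∈ γ.walk.edges) then (1 : ℝ) else 0)

/-- `L_δ(p) = log (G_δ(p, b_δ) / G_δ(p, a_δ))`, `G_δ` the Green function of SRW on `Ω_δ` killed at its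
first non-`Ω_δ` step. -/
def logGreenRatio (Ω : Set ℂ) (δ : ℝ) (a b p : Site 2) : ℝ :=
  Real.log (killedRegionGreen (discreteDomainGraph Ω δ) (meshDomain Ω δ) p b /
    killedRegionGreen (discreteDomainGraph Ω δ) (meshDomain Ω δ) p a)

/-- The discrete `∂_z` of `L_δ` at `p`: `[(L(p+e₁) − L(p−e₁)) − i (L(p+e₂) − L(p−e₂))] / (4δ)`. -/
def dLog (Ω : Set ℂ) (δ : ℝ) (a b p : Site 2) : ℂ :=
  (((logGreenRatio Ω δ a b (p + ![1, 0]) - logGreenRatio Ω δ a b (p - ![1, 0]) : ℝ) : ℂ) -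
      Complex.I * ((logGreenRatio Ω δ a b (p + ![0, 1]) - logGreenRatio Ω δ a b (p - ![0, 1]) : ℝ) : ℂ)) /
    (4 * δ)

/-! ### The two statements, named -/

/-- **S1, named.** The normalised quadrupole one-point functions are asymptotic, along interior
sequences, to the real / imaginary parts of the squared discrete logarithmic gradient of the
Green-function ratio — the lattice-intrinsic (slit-free) stress-tensor shape. -/
def LatticeShape : Prop :=
  ∃ A₁ A₂ : ℝ → ℝ, ∀ (D : DobrushinDomain) (a b z : ℝ → Site 2) (z₀ : ℂ),
    let X₁ : (δ : ℝ) → Site 2 → SAW.DomainSAW D.carrier δ (a δ) (b δ) → ℝ := fun _ v γ =>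
      (if s(v - ![1, 0], v) ∈ γ.walk.edges ∧ s(v, v + ![1, 0]) ∈ γ.walk.edges then (1 : ℝ) else 0) -
        (if s(v - ![0, 1], v) ∈ γ.walk.edges ∧ s(v, v + ![0, 1]) ∈ γ.walk.edges then (1 : ℝ) else 0)
    let X₂ : (δ : ℝ) → Site 2 → SAW.DomainSAW D.carrier δ (a δ) (b δ) → ℝ := fun _ v γ =>
      (if (s(v, v + ![1, 0]) ∈ γ.walk.edges ∧ s(v, v + ![0, 1]) ∈ γ.walk.edges) ∨
            (s(v - ![1, 0], v) ∈ γ.walk.edges ∧ s(v - ![0, 1], v) ∈ γ.walk.edges) then (1 : ℝ) else 0) -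
        (if (s(v - ![1, 0], v) ∈ γ.walk.edges ∧ s(v, v + ![0, 1]) ∈ γ.walk.edges) ∨
            (s(v, v + ![1, 0]) ∈ γ.walk.edges ∧ s(v - ![0, 1], v) ∈ γ.walk.edges) then (1 : ℝ) else 0)
    let L : ℝ → Site 2 → ℝ := fun δ p =>
      Real.log (killedRegionGreen (discreteDomainGraph D.carrier δ) (meshDomain D.carrier δ) p (b δ) /
        killedRegionGreen (discreteDomainGraph D.carrier δ) (meshDomain D.carrier δ) p (a δ))
    let DL : ℝ → Site 2 → ℂ := fun δ p =>
      (((L δ (p + ![1, 0]) - L δ (p - ![1, 0]) : ℝ) : ℂ) -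
          Complex.I * ((L δ (p + ![0, 1]) - L δ (p - ![0, 1]) : ℝ) : ℂ)) / (4 * δ)
    SAW.IsEndpointApprox D a b → z₀ ∈ D.carrier →
      Tendsto (fun δ => meshPoint δ (z δ)) (𝓝[>] 0) (𝓝 z₀) →
        Tendsto (fun δ => (∫ γ, X₁ δ (z δ) γ ∂(SAW.law D.carrier δ (a δ) (b δ))) / A₁ δ -
            ((DL δ (z δ)) ^ 2).re) (𝓝[>] 0) (𝓝 0) ∧
          Tendsto (fun δ => (∫ γ, X₂ δ (z δ) γ ∂(SAW.law D.carrier δ (a δ) (b δ))) / A₂ δ -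
            ((DL δ (z δ)) ^ 2).im) (𝓝[>] 0) (𝓝 0)

/-- **S2, named.** The discrete logarithmic gradient of the killed-walk Green-function ratio
(poles `b_δ`, `a_δ`) converges in the bulk to `ψ′/ψ`, `ψ = φ⁻¹` the chordal uniformizer onto `ℍ`. -/
def GreenLogGradient : Prop :=
  ∀ (D : DobrushinDomain) (a b z : ℝ → Site 2) (z₀ : ℂ)
    (φ : ConformalEquiv UpperHalfPlane.upperHalfPlaneSet D.carrier),
    let L : ℝ → Site 2 → ℝ := fun δ p =>
      Real.log (killedRegionGreen (discreteDomainGraph D.carrier δ) (meshDomain D.carrier δ) p (b δ) /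
        killedRegionGreen (discreteDomainGraph D.carrier δ) (meshDomain D.carrier δ) p (a δ))
    let DL : ℝ → Site 2 → ℂ := fun δ p =>
      (((L δ (p + ![1, 0]) - L δ (p - ![1, 0]) : ℝ) : ℂ) -
          Complex.I * ((L δ (p + ![0, 1]) - L δ (p - ![0, 1]) : ℝ) : ℂ)) / (4 * δ)
    SAW.IsEndpointApprox D a b → D.IsChordalUniformizing φ → z₀ ∈ D.carrier →
      Tendsto (fun δ => meshPoint δ (z δ)) (𝓝[>] 0) (𝓝 z₀) →
        Tendsto (fun δ => DL δ (z δ)) (𝓝[>] 0) (𝓝 (deriv φ.symm z₀ / φ.symm z₀))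

/-! ### The stubs (the ONLY `sorry`s of this file)

Stated over tree vocabulary only (the named statements above, unfolded by hand), so that each lands
verbatim as a `Theorems/…` file `--supports stmt-CriticalPhenomena-7750` without importing this
workfile; the `*_holds` theorems below certify definitionally that the unfolded text IS the named
statement. -/

/-- **S1 — the lattice-intrinsic (slit-free) stress-tensor shape.** There are amplitudes `A₁ A₂`
depending on the mesh only such that, for every Dobrushin domain, endpoint approximation and interior
sequence `z_δ → z₀ ∈ Ω`, `E_δ[X₁(z_δ)]/A₁(δ) − Re (D_z L_δ(z_δ))² → 0` and
`E_δ[X₂(z_δ)]/A₂(δ) − Im (D_z L_δ(z_δ))² → 0`, where `L_δ = log (G_δ(·, b_δ)/G_δ(·, a_δ))` is built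
from the Green function of simple random walk on `Ω_δ` killed at its first non-`Ω_δ` step and `D_z`
is the discrete `∂_z`. The `η = nil` case of `SlitQuadrupoleShape`, along interior sequences. -/
theorem stub_latticeShape :
    ∃ A₁ A₂ : ℝ → ℝ, ∀ (D : DobrushinDomain) (a b z : ℝ → Site 2) (z₀ : ℂ),
    let X₁ : (δ : ℝ) → Site 2 → SAW.DomainSAW D.carrier δ (a δ) (b δ) → ℝ := fun _ v γ =>
      (if s(v - ![1, 0], v) ∈ γ.walk.edges ∧ s(v, v + ![1, 0]) ∈ γ.walk.edges then (1 : ℝ) else 0) -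
        (if s(v - ![0, 1], v) ∈ γ.walk.edges ∧ s(v, v + ![0, 1]) ∈ γ.walk.edges then (1 : ℝ) else 0)
    let X₂ : (δ : ℝ) → Site 2 → SAW.DomainSAW D.carrier δ (a δ) (b δ) → ℝ := fun _ v γ =>
      (if (s(v, v + ![1, 0]) ∈ γ.walk.edges ∧ s(v, v + ![0, 1]) ∈ γ.walk.edges) ∨
            (s(v - ![1, 0], v) ∈ γ.walk.edges ∧ s(v - ![0, 1], v) ∈ γ.walk.edges) then (1 : ℝ) else 0) -
        (if (s(v - ![1, 0], v) ∈ γ.walk.edges ∧ s(v, v + ![0, 1]) ∈ γ.walk.edges) ∨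
            (s(v, v + ![1, 0]) ∈ γ.walk.edges ∧ s(v - ![0, 1], v) ∈ γ.walk.edges) then (1 : ℝ) else 0)
    let L : ℝ → Site 2 → ℝ := fun δ p =>
      Real.log (killedRegionGreen (discreteDomainGraph D.carrier δ) (meshDomain D.carrier δ) p (b δ) /
        killedRegionGreen (discreteDomainGraph D.carrier δ) (meshDomain D.carrier δ) p (a δ))
    let DL : ℝ → Site 2 → ℂ := fun δ p =>
      (((L δ (p + ![1, 0]) - L δ (p - ![1, 0]) : ℝ) : ℂ) -
          Complex.I * ((L δ (p + ![0, 1]) - L δ (p - ![0, 1]) : ℝ) : ℂ)) / (4 * δ)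
    SAW.IsEndpointApprox D a b → z₀ ∈ D.carrier →
      Tendsto (fun δ => meshPoint δ (z δ)) (𝓝[>] 0) (𝓝 z₀) →
        Tendsto (fun δ => (∫ γ, X₁ δ (z δ) γ ∂(SAW.law D.carrier δ (a δ) (b δ))) / A₁ δ -
            ((DL δ (z δ)) ^ 2).re) (𝓝[>] 0) (𝓝 0) ∧
          Tendsto (fun δ => (∫ γ, X₂ δ (z δ) γ ∂(SAW.law D.carrier δ (a δ) (b δ))) / A₂ δ -
            ((DL δ (z δ)) ^ 2).im) (𝓝[>] 0) (𝓝 0) := by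
  sorry

/-- **S2 — the random-walk shape converges to the conformal shape.** For every Dobrushin domain,
endpoint approximation, chordal uniformizer `φ : ℍ → Ω` (`0 ↦ a`, `∞ ↦ b`) and interior sequence
`z_δ → z₀ ∈ Ω`: `D_z L_δ(z_δ) → ψ′(z₀)/ψ(z₀)`, `ψ = φ.symm`. (Martin kernels at the two prime ends are
`c · Im ψ` and `c′ · Im ψ/|ψ|²`, so `L = 2 Re log ψ + const` and `∂_z L = ψ′/ψ`; discretely: Beurling +
boundary Harnack for the moving poles, interior `C¹` estimates for the gradient.) -/
theorem stub_greenLogGradient :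
    ∀ (D : DobrushinDomain) (a b z : ℝ → Site 2) (z₀ : ℂ)
    (φ : ConformalEquiv UpperHalfPlane.upperHalfPlaneSet D.carrier),
    let L : ℝ → Site 2 → ℝ := fun δ p =>
      Real.log (killedRegionGreen (discreteDomainGraph D.carrier δ) (meshDomain D.carrier δ) p (b δ) /
        killedRegionGreen (discreteDomainGraph D.carrier δ) (meshDomain D.carrier δ) p (a δ))
    let DL : ℝ → Site 2 → ℂ := fun δ p =>
      (((L δ (p + ![1, 0]) - L δ (p - ![1, 0]) : ℝ) : ℂ) -
          Complex.I * ((L δ (p + ![0, 1]) - L δ (p - ![0, 1]) : ℝ) : ℂ)) / (4 * δ)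
    SAW.IsEndpointApprox D a b → D.IsChordalUniformizing φ → z₀ ∈ D.carrier →
      Tendsto (fun δ => meshPoint δ (z δ)) (𝓝[>] 0) (𝓝 z₀) →
        Tendsto (fun δ => DL δ (z δ)) (𝓝[>] 0) (𝓝 (deriv φ.symm z₀ / φ.symm z₀)) := by
  sorry

/-! ### Consistency: each named statement IS its registered stub (definitionally) -/

theorem latticeShape_holds : LatticeShape := stub_latticeShape
theorem greenLogGradient_holds : GreenLogGradient := stub_greenLogGradient

/-! ### Name-keyed aliases of the two statements — the hypotheses of `QuadrupoleShape_of`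

The native skeleton audit (`#h21_check_skeleton`) admits a hypothesis of the skeleton theorem only if its
head constant is a registered obligation or is NAMED like a declared stub; `__Registered.stub_X` is the
statement of `stub_X` under that name (the `__` namespace is an implementation detail, so the audit's
stub report resolves each `stub_…` to the sorried theorem, not to the alias). Each alias is `rfl`-equal
to its statement. -/
namespace __Registered

/-- Alias of `LatticeShape` keyed by the registered stub name. -/
abbrev stub_latticeShape : Prop := LatticeShape
/-- Alias of `GreenLogGradient` keyed by the registered stub name. -/
abbrev stub_greenLogGradient : Prop := GreenLogGradient

end __Registered

/-! ### The skeleton theorem: the two stubs imply the crux, BY NAME -/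

/-- **`QuadrupoleShape` from the line `birth`** (kernel-checked, no `sorry` of its own): with the
amplitudes of S1, fix the data of the crux; S2 squared and composed with the (continuous) real and
imaginary parts gives `Re/Im (D_z L_δ(z_δ))² → Re/Im (ψ′(z₀)/ψ(z₀))²`; adding S1 and cancelling
`(E/A − Re S_δ) + Re S_δ = E/A` gives the two limits, and `(ψ′/ψ)² = ψ′²/ψ²` (`div_pow`) is the crux's
spelling. Hypotheses = the two stubs under their registered names; conclusion = the route decl, by name. -/
theorem QuadrupoleShape_of (h₁ : __Registered.stub_latticeShape)
    (h₂ : __Registered.stub_greenLogGradient) :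
    Summit.CriticalPhenomena.SAWScalingLimit.Theses.SAWStressTensor.QuadrupoleShape := by
  obtain ⟨A₁, A₂, hA⟩ := h₁
  refine ⟨A₁, A₂, ?_⟩
  intro D a b z z₀ φ X₁ X₂ hE hφ hz₀ hz
  obtain ⟨hB₁, hB₂⟩ := hA D a b z z₀ hE hz₀ hz
  have hG : Tendsto (fun δ => dLog D.carrier δ (a δ) (b δ) (z δ)) (𝓝[>] 0)
      (𝓝 (deriv φ.symm z₀ / φ.symm z₀)) :=
    h₂ D a b z z₀ φ hE hφ hz₀ hz
  have hB₁' : Tendsto (fun δ => (∫ γ, quadB1 (z δ) γ ∂(SAW.law D.carrier δ (a δ) (b δ))) / A₁ δ -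
      ((dLog D.carrier δ (a δ) (b δ) (z δ)) ^ 2).re) (𝓝[>] 0) (𝓝 0) := hB₁
  have hB₂' : Tendsto (fun δ => (∫ γ, quadB2 (z δ) γ ∂(SAW.law D.carrier δ (a δ) (b δ))) / A₂ δ -
      ((dLog D.carrier δ (a δ) (b δ) (z δ)) ^ 2).im) (𝓝[>] 0) (𝓝 0) := hB₂
  have hG2 : Tendsto (fun δ => (dLog D.carrier δ (a δ) (b δ) (z δ)) ^ 2) (𝓝[>] 0)
      (𝓝 ((deriv φ.symm z₀ / φ.symm z₀) ^ 2)) := hG.pow 2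
  have hre : Tendsto (fun δ => ((dLog D.carrier δ (a δ) (b δ) (z δ)) ^ 2).re) (𝓝[>] 0)
      (𝓝 ((deriv φ.symm z₀ / φ.symm z₀) ^ 2).re) :=
    (Complex.continuous_re.tendsto _).comp hG2
  have him : Tendsto (fun δ => ((dLog D.carrier δ (a δ) (b δ) (z δ)) ^ 2).im) (𝓝[>] 0)
      (𝓝 ((deriv φ.symm z₀ / φ.symm z₀) ^ 2).im) :=
    (Complex.continuous_im.tendsto _).comp hG2
  have hpow : (deriv φ.symm z₀ / φ.symm z₀) ^ 2 = deriv φ.symm z₀ ^ 2 / φ.symm z₀ ^ 2 :=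
    div_pow _ _ 2
  refine ⟨?_, ?_⟩
  · have h := hB₁'.add hre
    rw [zero_add, hpow] at h
    have h' : Tendsto (fun δ => (∫ γ, quadB1 (z δ) γ ∂(SAW.law D.carrier δ (a δ) (b δ))) / A₁ δ)
        (𝓝[>] 0) (𝓝 (deriv φ.symm z₀ ^ 2 / φ.symm z₀ ^ 2).re) := by
      refine h.congr fun δ => ?_
      simp only [sub_add_cancel]
    exact h'
  · have h := hB₂'.add him
    rw [zero_add, hpow] at h
    have h' : Tendsto (fun δ => (∫ γ, quadB2 (z δ) γ ∂(SAW.law D.carrier δ (a δ) (b δ))) / A₂ δ)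
        (𝓝[>] 0) (𝓝 (deriv φ.symm z₀ ^ 2 / φ.symm z₀ ^ 2).im) := by
      refine h.congr fun δ => ?_
      simp only [sub_add_cancel]
    exact h'

/-- Wiring check (an `example`, so that `QuadrupoleShape_of` stays the only theorem concluding the
crux): the registered stubs, with their tree-vocabulary types, feed the skeleton theorem as stated —
this term becomes the crux proof when the two `sorry`s above are discharged. -/
example : Summit.CriticalPhenomena.SAWScalingLimit.Theses.SAWStressTensor.QuadrupoleShape :=
  QuadrupoleShape_of stub_latticeShape stub_greenLogGradient

end Summit.CriticalPhenomena.SAWScalingLimit.Cruxes.QuadrupoleShape.Birth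

end
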